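import Mathlib.Data.Finset.Card
import Literature.Probability.RandomPlanarGeometry.USTPeanoParity
import HarnessLib

/-!
# Peeling data: the combinatorial skeleton of the UST Peano path existence ([LSW04] §4.1)

G. F. Lawler, O. Schramm, W. Werner, Ann. Probab. **32** (2004), §4.1, pp. 971–972, prove that
every `D = D(α, β, a, b) ∈ 𝔇*` carries an oriented simple path of the Manhattan lattice `G⃗` from
`a` to `b` through all the Peano vertices of `D`, whose edges do not meet `α ∪ β` (the UST Peano
paths). Their proof builds a spanning tree; ours (`USTPeanoPeelingStep.lean`) peels the path off
vertex by vertex, as in their Markov property (Lemma 4.1: conditioned on `γ[0, n]`, the rest is the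
Peano curve of `D(αₙ, βₙ, γ(n), b)`), and works with the following purely combinatorial data,
extracted from a domain once (`USTPeanoLocal.lean`):

* `PeelData` — a finite set `V` of Peano indices (the Peano vertices in `D`), the primal wall
  `α` and the dual wall `β` (index lists) and the endpoints `a`, `b`;
* `PeelData.Blocked S p q` — the Manhattan edge `p → q` crosses an edge of `α` (if it is the
  primal step of `p`) or of `β` (if it is the dual step), combinatorially (`edgeSet`);
* `PeelData.Good S` — the axioms: `α`, `β` are simple lattice paths from the neighbours of `a` to
  the neighbours of `b` (X0), no edge of `α` is dual to an edge of `β` (X1), and the closure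
  property (X2): an unblocked Manhattan edge from `a` or from a vertex of `V` ends in `V` or at
  `b` (never at `a`);
* `PeelData.IsPath S l` — `l` is a Peano path for `S`: a simple Manhattan path from `a` to `b`
  with vertex set `V ∪ {a, b}` and unblocked edges;
* `PeelData.swap` — the primal/dual exchange (`swapIdx`), under which `Good` and `IsPath` are
  invariant (`Good.swap`, `IsPath.of_swap`);
* `eq_empty_of_forall_step_mem` — the escape lemma (a finite set of Peano vertices closed under
  both Manhattan steps into `V ∪ {b}` is empty: rows and columns are one-way streets);
* `Good.exists_isPath_of_empty` — the case `V = ∅`.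
-/

namespace Literature.Probability.RandomPlanarGeometry

namespace USTPeano

/-! ### The edges of an index list -/

/-- The (unordered) edges of a lattice path given as an index list: its consecutive pairs.
[folklore] -/
def edgeSet (l : List (ℤ × ℤ)) : List (Sym2 (ℤ × ℤ)) := (l.zip l.tail).map fun e ↦ s(e.1, e.2)

/-- The edges of `x :: y :: l`. [folklore] -/
@[simp] theorem edgeSet_cons_cons (x y : ℤ × ℤ) (l : List (ℤ × ℤ)) :
    edgeSet (x :: y :: l) = s(x, y) :: edgeSet (y :: l) := rfl

/-- A one-vertex path has no edges. [folklore] -/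
@[simp] theorem edgeSet_singleton (x : ℤ × ℤ) : edgeSet [x] = [] := rfl

/-- The empty path has no edges. [folklore] -/
@[simp] theorem edgeSet_nil : edgeSet [] = [] := rfl

/-- Membership in `edgeSet`. [folklore] -/
theorem mem_edgeSet_iff {l : List (ℤ × ℤ)} {e : Sym2 (ℤ × ℤ)} :
    e ∈ edgeSet l ↔ ∃ p ∈ l.zip l.tail, s(p.1, p.2) = e := by
  simp [edgeSet]

/-- The endpoints of an edge are vertices of the path. [folklore] -/
theorem mem_of_mem_edgeSet {l : List (ℤ × ℤ)} {u v : ℤ × ℤ} (h : s(u, v) ∈ edgeSet l) :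
    u ∈ l ∧ v ∈ l := by
  obtain ⟨p, hp, he⟩ := mem_edgeSet_iff.1 h
  obtain ⟨i, j⟩ := p
  have h1 := List.of_mem_zip hp
  rcases Sym2.eq_iff.1 he with ⟨rfl, rfl⟩ | ⟨rfl, rfl⟩
  · exact ⟨h1.1, List.mem_of_mem_tail h1.2⟩
  · exact ⟨List.mem_of_mem_tail h1.2, h1.1⟩

/-- The consecutive pairs of a prefix are consecutive pairs of the list. [folklore] -/
theorem zip_tail_sublist_append :
    ∀ (l₁ l₂ : List (ℤ × ℤ)), (l₁.zip l₁.tail).Sublist ((l₁ ++ l₂).zip (l₁ ++ l₂).tail)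
  | [], _ => by simp
  | [x], _ => by simp
  | x :: y :: l, l₂ => by
    rw [zip_tail_cons_cons, List.cons_append, List.cons_append,
      zip_tail_cons_cons x y (l ++ l₂), ← List.cons_append]
    exact (zip_tail_sublist_append (y :: l) l₂).cons_cons _

/-- The consecutive pairs of the tail are consecutive pairs of the list. [folklore] -/
theorem zip_tail_tail_sublist :
    ∀ l : List (ℤ × ℤ), (l.tail.zip l.tail.tail).Sublist (l.zip l.tail)
  | [] => by simp
  | [x] => by simp
  | x :: y :: l => by
    rw [zip_tail_cons_cons]
    exact List.sublist_cons_self _ _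

/-- The consecutive pairs of `l ++ [z]`. [folklore] -/
theorem zip_tail_append_singleton :
    ∀ (l : List (ℤ × ℤ)) (h : l ≠ []) (z : ℤ × ℤ),
      (l ++ [z]).zip (l ++ [z]).tail = l.zip l.tail ++ [(l.getLast h, z)]
  | [], h, _ => absurd rfl h
  | [x], _, z => rfl
  | x :: y :: l, _, z => by
    rw [List.cons_append, List.cons_append, zip_tail_cons_cons x y (l ++ [z]), ← List.cons_append,
      zip_tail_append_singleton (y :: l) (List.cons_ne_nil y l) z, zip_tail_cons_cons,
      List.getLast_cons (List.cons_ne_nil y l)]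
    rfl

/-- The edges of a prefix are edges of the list. [folklore] -/
theorem edgeSet_append_subset (l₁ l₂ : List (ℤ × ℤ)) : edgeSet l₁ ⊆ edgeSet (l₁ ++ l₂) :=
  List.map_subset _ (zip_tail_sublist_append l₁ l₂).subset

/-- The edges of the tail are edges of the list. [folklore] -/
theorem edgeSet_tail_subset (l : List (ℤ × ℤ)) : edgeSet l.tail ⊆ edgeSet l :=
  List.map_subset _ (zip_tail_tail_sublist l).subset

/-- The edges of a mapped list. [folklore] -/
theorem edgeSet_map (f : ℤ × ℤ → ℤ × ℤ) (l : List (ℤ × ℤ)) :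
    edgeSet (l.map f) = (edgeSet l).map (Sym2.map f) := by
  unfold edgeSet
  rw [← List.map_tail, List.zip_map, List.map_map, List.map_map]
  rfl

/-- Membership of a swapped edge in the edges of a swapped list. [folklore] -/
theorem mem_edgeSet_map_swapIdx {l : List (ℤ × ℤ)} {u v : ℤ × ℤ} :
    s(swapIdx u, swapIdx v) ∈ edgeSet (l.map swapIdx) ↔ s(u, v) ∈ edgeSet l := by
  rw [edgeSet_map, show s(swapIdx u, swapIdx v) = Sym2.map swapIdx s(u, v) by simp]
  exact List.mem_map_of_injective (Sym2.map.injective swapIdx_injective)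

/-- Membership of a mapped consecutive pair. [folklore] -/
theorem mem_zip_tail_map_iff {f : ℤ × ℤ → ℤ × ℤ} {l : List (ℤ × ℤ)} {e : (ℤ × ℤ) × (ℤ × ℤ)} :
    e ∈ (l.map f).zip (l.map f).tail ↔ ∃ p ∈ l.zip l.tail, (f p.1, f p.2) = e := by
  rw [← List.map_tail, List.zip_map, List.mem_map]
  rfl

/-- **The first edge.** In a simple path starting at `x`, the edge `{x, y}` is present iff `y`
is the second vertex. [folklore] -/
theorem mem_edgeSet_head_iff {l : List (ℤ × ℤ)} {x y : ℤ × ℤ} (hl : l ≠ []) (hnd : l.Nodup)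
    (hx : l.head hl = x) : s(x, y) ∈ edgeSet l ↔ ∃ t, l = x :: y :: t := by
  obtain ⟨x', l', rfl⟩ := List.exists_cons_of_ne_nil hl
  rw [List.head_cons] at hx
  subst hx
  constructor
  · intro h
    cases l' with
    | nil => simp at h
    | cons z t =>
      rw [edgeSet_cons_cons, List.mem_cons] at h
      rcases h with h | h
      · rcases Sym2.eq_iff.1 h with ⟨-, rfl⟩ | ⟨rfl, rfl⟩
        · exact ⟨t, rfl⟩
        · exact ⟨t, rfl⟩
      · exfalso
        have hx := (mem_of_mem_edgeSet h).1
        exact (List.nodup_cons.1 hnd).1 hx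
  · rintro ⟨t, ht⟩
    rw [ht, edgeSet_cons_cons]
    exact List.mem_cons_self

/-- A simple path with equal ends has one vertex. [folklore] -/
theorem eq_singleton_of_head_eq_getLast {X : Type*} {l : List X} (hl : l ≠ []) (hnd : l.Nodup)
    (h : l.head hl = l.getLast hl) : l = [l.head hl] := by
  obtain ⟨x, t, rfl⟩ := List.exists_cons_of_ne_nil hl
  cases t with
  | nil => rfl
  | cons y t =>
    exfalso
    rw [List.head_cons, List.getLast_cons (List.cons_ne_nil y t)] at h
    have hmem : x ∈ y :: t := h ▸ List.getLast_mem _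
    exact (List.nodup_cons.1 hnd).1 hmem

/-- A simple path `x :: y :: t` whose last vertex is `y` is `[x, y]`. [folklore] -/
theorem eq_nil_of_getLast_eq {X : Type*} {x y : X} {t : List X} (hnd : (x :: y :: t).Nodup)
    (h : (x :: y :: t).getLast (List.cons_ne_nil _ _) = y) : t = [] := by
  have h2 : (y :: t).getLast (List.cons_ne_nil y t) = y := by rwa [List.getLast_cons] at h
  have h' := eq_singleton_of_head_eq_getLast (List.cons_ne_nil y t) (List.nodup_cons.1 hnd).2
    (by rw [List.head_cons, h2])
  exact (List.cons_eq_cons.1 h').2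

/-! ### Peeling data -/

/-- **Peeling data**: the combinatorial content of a domain `D(α, β, a, b)` relevant for its Peano
paths — the set `V` of (indices of) Peano vertices in `D`, the primal wall `α` and the dual wall
`β` as index lists, and the two marked Peano vertices. [cite: LawlerSchrammWerner2004, §4.1] -/
structure PeelData where
  /-- the Peano vertices in `D` -/
  V : Finset (ℤ × ℤ)
  /-- the primal (wired) wall `α`, from `α_a` to `α_b` -/
  α : List (ℤ × ℤ)
  /-- the dual (free) wall `β`, from `β_a` to `β_b` -/
  β : List (ℤ × ℤ)
  /-- the initial Peano vertex -/
  a : ℤ × ℤ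
  /-- the terminal Peano vertex -/
  b : ℤ × ℤ

namespace PeelData

variable (S : PeelData)

/-- **Blocked Manhattan edges**: the edge `p → q` of `G⃗` crosses the wall — it is the primal step
of `p` and the primal edge it crosses is an edge of `α`, or it is the dual step and the dual edge
it crosses is an edge of `β` ("edges of `G⃗` which intersect `T ∪ T†`", [LSW04] p. 971, for
`T = α`, `T† = β`). [cite: LawlerSchrammWerner2004, §4.1] -/
def Blocked (p q : ℤ × ℤ) : Prop :=
  (q = stepP p ∧ s(primalNbr p, farP p) ∈ edgeSet S.α) ∨
    (q = stepD p ∧ s(dualNbr p, farD p) ∈ edgeSet S.β)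

/-- **The axioms of peeling data** (all satisfied by a domain `D ∈ 𝔇*` with `α`, `β` simple,
`USTPeanoLocal.lean`): (X0) `α`, `β` are nonempty simple lattice paths from the primal/dual
neighbour of `a` to that of `b`, `a ≠ b`, `a, b ∉ V`; (X1) no edge of `α` is dual to (crosses) an
edge of `β`; (X2) closure: an unblocked Manhattan edge from `a` or from a vertex of `V` ends in `V`
or at `b`. [cite: LawlerSchrammWerner2004, §4.1] -/
structure Good : Prop where
  /-- `α` is nonempty -/
  α_ne : S.α ≠ []
  /-- `β` is nonempty -/
  β_ne : S.β ≠ []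
  /-- `α` is a lattice path -/
  chainα : S.α.IsChain LatticeAdj
  /-- `β` is a lattice path -/
  chainβ : S.β.IsChain LatticeAdj
  /-- `α` starts next to `a` -/
  headα : S.α.head α_ne = primalNbr S.a
  /-- `β` starts next to `a` -/
  headβ : S.β.head β_ne = dualNbr S.a
  /-- `α` ends next to `b` -/
  lastα : S.α.getLast α_ne = primalNbr S.b
  /-- `β` ends next to `b` -/
  lastβ : S.β.getLast β_ne = dualNbr S.b
  /-- `α` is simple -/
  nodupα : S.α.Nodup
  /-- `β` is simple -/
  nodupβ : S.β.Nodup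
  /-- the endpoints differ -/
  a_ne_b : S.a ≠ S.b
  /-- `a` is not an interior vertex -/
  a_notMem : S.a ∉ S.V
  /-- `b` is not an interior vertex -/
  b_notMem : S.b ∉ S.V
  /-- (X1) no edge of `α` crosses an edge of `β` -/
  nocross : ∀ e ∈ S.α.zip S.α.tail, ∀ f ∈ S.β.zip S.β.tail, ¬ IsDualPair e.1 e.2 f.1 f.2
  /-- (X2) closure under unblocked steps -/
  closed : ∀ p, (p = S.a ∨ p ∈ S.V) → ∀ q, Manhattan p q → ¬ S.Blocked p q → q = S.b ∨ q ∈ S.V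

/-- **Peano paths of peeling data**: a simple oriented path `a = w₀ → ⋯ → w_{ℓ+1} = b` of `G⃗`
whose vertex set is `V ∪ {a, b}` and whose edges are not blocked.
[cite: LawlerSchrammWerner2004, §4.1] -/
structure IsPath (l : List (ℤ × ℤ)) : Prop where
  /-- the path is nonempty -/
  ne_nil : l ≠ []
  /-- it starts at `a` -/
  head_eq : l.head ne_nil = S.a
  /-- it ends at `b` -/
  getLast_eq : l.getLast ne_nil = S.b
  /-- it follows the Manhattan orientation -/
  isChain : l.IsChain Manhattan
  /-- it is simple -/
  nodup : l.Nodup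
  /-- its vertex set is `V ∪ {a, b}` -/
  mem_iff : ∀ p, p ∈ l ↔ p = S.a ∨ p = S.b ∨ p ∈ S.V
  /-- its edges are not blocked -/
  unblocked : ∀ e ∈ l.zip l.tail, ¬ S.Blocked e.1 e.2

/-! ### Unblocked steps from `a` -/

/-- The dual step is blocked iff the crossed dual edge is an edge of `β`. [folklore] -/
theorem blocked_stepD_iff (p : ℤ × ℤ) :
    S.Blocked p (stepD p) ↔ s(dualNbr p, farD p) ∈ edgeSet S.β := by
  simp [Blocked, stepD_ne_stepP]

/-- The primal step is blocked iff the crossed primal edge is an edge of `α`. [folklore] -/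
theorem blocked_stepP_iff (p : ℤ × ℤ) :
    S.Blocked p (stepP p) ↔ s(primalNbr p, farP p) ∈ edgeSet S.α := by
  simp [Blocked, (stepD_ne_stepP p).symm]

variable {S}

/-- (X1) at `a`: the two edges crossed from `a` are not both walls. [folklore] -/
theorem Good.not_both_mem (h : S.Good) (p : ℤ × ℤ) :
    ¬ (s(primalNbr p, farP p) ∈ edgeSet S.α ∧ s(dualNbr p, farD p) ∈ edgeSet S.β) := by
  rintro ⟨h1, h2⟩
  obtain ⟨e, he, hee⟩ := mem_edgeSet_iff.1 h1
  obtain ⟨f, hf, hff⟩ := mem_edgeSet_iff.1 h2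
  exact h.nocross e he f hf ((isDualPair_congr hee hff).2 (isDualPair_far p))

/-- (X2) at `a`, dual step: if the dual edge at `a` is not a wall, `stepD a ∈ V ∪ {b}`. [folklore] -/
theorem Good.stepD_mem (h : S.Good) (ha : s(dualNbr S.a, farD S.a) ∉ edgeSet S.β) :
    stepD S.a = S.b ∨ stepD S.a ∈ S.V :=
  h.closed S.a (Or.inl rfl) _ (manhattan_stepD _) (by rwa [blocked_stepD_iff])

/-- (X2) at `a`, primal step. [folklore] -/
theorem Good.stepP_mem (h : S.Good) (ha : s(primalNbr S.a, farP S.a) ∉ edgeSet S.α) :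
    stepP S.a = S.b ∨ stepP S.a ∈ S.V :=
  h.closed S.a (Or.inl rfl) _ (manhattan_stepP _) (by rwa [blocked_stepP_iff])

/-! ### The case `V = ∅` -/

/-- The two-vertex path `[a, q]` is a Peano path when `V = ∅`, `q = b` and the edge is unblocked.
[folklore] -/
theorem isPath_pair (hV : S.V = ∅) {q : ℤ × ℤ} (hq : q = S.b) (hm : Manhattan S.a q)
    (hu : ¬ S.Blocked S.a q) (hab : S.a ≠ S.b) : S.IsPath [S.a, q] where
  ne_nil := by simp
  head_eq := rfl
  getLast_eq := by simp [hq]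
  isChain := List.isChain_pair.2 hm
  nodup := by simp [hq, hab]
  mem_iff p := by simp [hq, hV]
  unblocked e he := by
    simp only [List.tail_cons, List.zip_cons_cons, List.zip_nil_right, List.mem_cons,
      List.not_mem_nil, or_false] at he
    subst he
    exact hu

/-- **Base case**: peeling data with no interior vertex has the Peano path `[a, b]`. [folklore] -/
theorem Good.exists_isPath_of_empty (h : S.Good) (hV : S.V = ∅) : ∃ l, S.IsPath l := by
  by_cases hD : s(dualNbr S.a, farD S.a) ∈ edgeSet S.β
  · have hP : s(primalNbr S.a, farP S.a) ∉ edgeSet S.α := fun hP ↦ h.not_both_mem S.a ⟨hP, hD⟩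
    have hq := h.stepP_mem hP
    rw [hV] at hq
    simp only [Finset.notMem_empty, or_false] at hq
    exact ⟨_, isPath_pair hV hq (manhattan_stepP _) (by rwa [blocked_stepP_iff]) h.a_ne_b⟩
  · have hq := h.stepD_mem hD
    rw [hV] at hq
    simp only [Finset.notMem_empty, or_false] at hq
    exact ⟨_, isPath_pair hV hq (manhattan_stepD _) (by rwa [blocked_stepD_iff]) h.a_ne_b⟩

/-! ### The escape lemma -/

/-- **Rows and columns are one-way streets**: a finite set `V` of Peano vertices, not containing
`b`, such that both Manhattan steps from every vertex of `V` stay in `V ∪ {b}`, is empty. (From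
`p ∈ V` follow the row: it leaves `V` only at `b`, so `b` is in the row of `p`; likewise `b` is in
the column of `p`; so `p = b`.) [folklore] -/
theorem eq_empty_of_forall_step_mem (V : Finset (ℤ × ℤ)) (b : ℤ × ℤ) (hb : b ∉ V)
    (h : ∀ p ∈ V, hStep p ∈ insert b V ∧ vStep p ∈ insert b V) : V = ∅ := by
  -- an injective orbit in `V ∪ {b}` starting in `V` passes through `b`
  have key : ∀ (f : ℕ → ℤ × ℤ), Function.Injective f → f 0 ∈ V →
      (∀ k, f k ∈ V → f (k + 1) ∈ insert b V) → ∃ k, f k = b := by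
    intro f hf h0 hstep
    by_contra hne
    have hne' : ∀ k, f k ≠ b := fun k hk ↦ hne ⟨k, hk⟩
    have hall : ∀ k, f k ∈ V := by
      intro k
      induction k with
      | zero => exact h0
      | succ k ih =>
        have := hstep k ih
        rw [Finset.mem_insert] at this
        exact this.resolve_left (hne' _)
    obtain ⟨x, -, y, -, hxy, hfxy⟩ := Finset.exists_ne_map_eq_of_card_lt_of_maps_to
      (s := Finset.range (V.card + 1)) (t := V) (f := f) (by simp) fun k _ ↦ hall k
    exact hxy (hf hfxy)
  by_contra hV
  obtain ⟨p, hp⟩ := Finset.nonempty_iff_ne_empty.2 hV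
  -- the row of `p` contains `b`
  obtain ⟨k, hk⟩ := key (fun k ↦ hStep^[k] p) (hStep_iterate_injective p) hp fun k hk ↦ by
    rw [Function.iterate_succ_apply']; exact (h _ hk).1
  -- the column of `p` contains `b`
  obtain ⟨k', hk'⟩ := key (fun k ↦ vStep^[k] p) (vStep_iterate_injective p) hp fun k hk ↦ by
    rw [Function.iterate_succ_apply']; exact (h _ hk).2
  have h2 : b.2 = p.2 := by rw [← hk]; exact (hStep_iterate_snd p k).1
  have h1 : b.1 = p.1 := by rw [← hk']; exact (hStep_iterate_snd p k').2
  exact hb (by rwa [show b = p from Prod.ext h1 h2])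

/-! ### The primal/dual exchange -/

variable (S)

/-- **The exchanged data**: apply `swapIdx` throughout and exchange the roles of `α` and `β`.
[folklore] -/
def swap : PeelData where
  V := S.V.map ⟨swapIdx, swapIdx_injective⟩
  α := S.β.map swapIdx
  β := S.α.map swapIdx
  a := swapIdx S.a
  b := swapIdx S.b

/-- Components of the exchanged data. [folklore] -/
@[simp] theorem swap_a : S.swap.a = swapIdx S.a := rfl

/-- Components of the exchanged data. [folklore] -/
@[simp] theorem swap_b : S.swap.b = swapIdx S.b := rfl

/-- Components of the exchanged data. [folklore] -/
@[simp] theorem swap_α : S.swap.α = S.β.map swapIdx := rfl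

/-- Components of the exchanged data. [folklore] -/
@[simp] theorem swap_β : S.swap.β = S.α.map swapIdx := rfl

/-- The interior vertices of the exchanged data. [folklore] -/
@[simp] theorem mem_swap_V {p : ℤ × ℤ} : p ∈ S.swap.V ↔ swapIdx p ∈ S.V := by
  simp only [swap, Finset.mem_map, Function.Embedding.coeFn_mk]
  constructor
  · rintro ⟨q, hq, rfl⟩
    rwa [swapIdx_swapIdx]
  · intro h
    exact ⟨swapIdx p, h, swapIdx_swapIdx p⟩

/-- The number of interior vertices is unchanged. [folklore] -/
@[simp] theorem card_swap_V : S.swap.V.card = S.V.card := Finset.card_map _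

/-- **Blocked edges are exchanged.** [folklore] -/
theorem blocked_swap_iff (p q : ℤ × ℤ) : S.swap.Blocked (swapIdx p) (swapIdx q) ↔ S.Blocked p q := by
  simp only [Blocked, swap, stepP_swapIdx, stepD_swapIdx, swapIdx_injective.eq_iff,
    primalNbr_swapIdx, farP_swapIdx, dualNbr_swapIdx, farD_swapIdx, mem_edgeSet_map_swapIdx]
  exact or_comm

variable {S}

/-- **`Good` is invariant under the exchange.** [folklore] -/
theorem Good.swap (h : S.Good) : S.swap.Good where
  α_ne := by simpa [PeelData.swap] using h.β_ne
  β_ne := by simpa [PeelData.swap] using h.α_ne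
  chainα := List.isChain_map_of_isChain swapIdx (fun _ _ hab ↦ (latticeAdj_swapIdx _ _).2 hab)
    h.chainβ
  chainβ := List.isChain_map_of_isChain swapIdx (fun _ _ hab ↦ (latticeAdj_swapIdx _ _).2 hab)
    h.chainα
  headα := by simp [PeelData.swap, List.head_map, h.headβ]
  headβ := by simp [PeelData.swap, List.head_map, h.headα]
  lastα := by simp [PeelData.swap, List.getLast_map, h.lastβ]
  lastβ := by simp [PeelData.swap, List.getLast_map, h.lastα]
  nodupα := h.nodupβ.map swapIdx_injective
  nodupβ := h.nodupα.map swapIdx_injective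
  a_ne_b := fun hab ↦ h.a_ne_b (swapIdx_injective hab)
  a_notMem := by simpa [mem_swap_V] using h.a_notMem
  b_notMem := by simpa [mem_swap_V] using h.b_notMem
  nocross := by
    intro e he f hf
    obtain ⟨w, hw, rfl⟩ := mem_zip_tail_map_iff.1 he
    obtain ⟨u, hu, rfl⟩ := mem_zip_tail_map_iff.1 hf
    rw [isDualPair_swapIdx]
    exact h.nocross u hu w hw
  closed := by
    intro p' hp' q' hm hbl
    -- write `p' = swapIdx p`, `q' = swapIdx q`
    obtain ⟨p, rfl⟩ : ∃ p, p' = swapIdx p := ⟨swapIdx p', (swapIdx_swapIdx p').symm⟩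
    obtain ⟨q, rfl⟩ : ∃ q, q' = swapIdx q := ⟨swapIdx q', (swapIdx_swapIdx q').symm⟩
    have hp : p = S.a ∨ p ∈ S.V := by
      rcases hp' with h1 | h1
      · exact Or.inl (swapIdx_injective h1)
      · exact Or.inr (by simpa [mem_swap_V] using h1)
    rw [manhattan_swapIdx] at hm
    rw [blocked_swap_iff] at hbl
    rcases h.closed p hp q hm hbl with h1 | h1
    · exact Or.inl (congrArg swapIdx h1)
    · exact Or.inr (by simpa [mem_swap_V] using h1)

/-- **Peano paths are exchanged**: a Peano path of the exchanged data, read back through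
`swapIdx`, is a Peano path. [folklore] -/
theorem IsPath.of_swap {l : List (ℤ × ℤ)} (hl : S.swap.IsPath l) : S.IsPath (l.map swapIdx) where
  ne_nil := by simpa using hl.ne_nil
  head_eq := by
    rw [List.head_map, hl.head_eq]
    exact swapIdx_swapIdx _
  getLast_eq := by
    rw [List.getLast_map, hl.getLast_eq]
    exact swapIdx_swapIdx _
  isChain := List.isChain_map_of_isChain swapIdx (fun _ _ hab ↦ (manhattan_swapIdx _ _).2 hab)
    hl.isChain
  nodup := hl.nodup.map swapIdx_injective
  mem_iff p := by
    have key := hl.mem_iff (swapIdx p)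
    rw [mem_swap_V] at key
    constructor
    · intro hp
      obtain ⟨q, hq, rfl⟩ := List.mem_map.1 hp
      rw [swapIdx_swapIdx] at key
      rcases key.1 hq with h1 | h1 | h1
      · exact Or.inl (by rw [h1]; exact swapIdx_swapIdx _)
      · exact Or.inr (Or.inl (by rw [h1]; exact swapIdx_swapIdx _))
      · exact Or.inr (Or.inr h1)
    · intro hp
      have : swapIdx p ∈ l := by
        refine key.2 ?_
        rcases hp with rfl | rfl | h1
        · exact Or.inl rfl
        · exact Or.inr (Or.inl rfl)
        · exact Or.inr (Or.inr (by rwa [swapIdx_swapIdx]))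
      exact List.mem_map.2 ⟨swapIdx p, this, swapIdx_swapIdx p⟩
  unblocked e he := by
    obtain ⟨f, hf, rfl⟩ := mem_zip_tail_map_iff.1 he
    have := hl.unblocked f hf
    show ¬ S.Blocked (swapIdx f.1) (swapIdx f.2)
    rw [← blocked_swap_iff, swapIdx_swapIdx, swapIdx_swapIdx]
    exact this

end PeelData

end USTPeano

end Literature.Probability.RandomPlanarGeometry
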